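import Mathlib.Analysis.Matrix.HermitianFunctionalCalculus
import Mathlib.Analysis.Matrix.Order
import Mathlib.Analysis.SpecialFunctions.Log.NegMulLog
import Literature.Computability.QuantumComplexity.QuantumMarginals
import Literature.InformationTheory.Entropy.VonNeumannEntropy
import Literature.InformationTheory.Entropy.RelativeEntropyMonotonicityDensity
import HarnessLib

/-!
# Von Neumann entropy of finite quantum systems: weak monotonicity (Lieb–Ruskai 1973) and
# monotonicity of the relative entropy under a partial trace (Lindblad 1975)

Topic `InformationTheory/Entropy`. Finite-dimensional quantum systems are matrices over `ℂ`
indexed by a finite type; a composite system `ℋ_X ⊗ ℋ_S ⊗ ℋ_Y` is a matrix indexed by the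
product type `X × S × Y`; partial traces and density operators are the tree's
`Literature.Computability.QuantumComplexity.traceLeft / traceRight / IsDensity`
(`QuantumMarginals.lean`, Bürgisser–Christandl–Ikenmeyer §2.2), not re-declared here.

* the von Neumann entropy `vonNeumannEntropy ρ = S(ρ) = Σᵢ η(λᵢ)`, `η(x) = −x log x`, is the tree's
  (`Literature/InformationTheory/Entropy/VonNeumannEntropy.lean`, with `vonNeumannEntropy_eq`,
  `vonNeumannEntropy_nonneg`), imported, not re-declared; here `vonNeumannEntropy_eq_re_trace_cfc_negMulLog`
  bridges it to Mathlib's continuous functional calculus for Hermitian matrices (`S(ρ) = Re Tr cfc η ρ`),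
  the form in which it meets `Tr(ρ log ρ)`. [cite: NielsenChuang2010, §11.3 eqs. (11.39)–(11.40)]
* `quantumRelEntropy ρ σ = S(ρ‖σ) = Tr ρ (log ρ − log σ)` (Umegaki; finite when `σ > 0`, which is
  the only case vendored below). [cite: NielsenChuang2010, §11.3.1 eq. (11.50)]
  [cite: Lindblad1975, p.147]
* `traceLast` — the partial trace over the LAST factor of `X × S × Y` (a reindexing of
  `traceRight`), so that the four marginals `ρ_XS, ρ_SY, ρ_X, ρ_Y` of a tripartite state are
  one-liners.
* NAMED FACT `weak_monotonicity` (Lieb–Ruskai 1973; Nielsen–Chuang Thm 11.14, eq. (11.107)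
  "`S(A) + S(B) ≤ S(A,C) + S(B,C)` for any trio of quantum systems"; = Fawzi–Fawzi–Scalet 2024
  Lemma 2.1 "weak monotonicity" `S(A|B) + S(A|C) ≥ 0`; = Moriya 2005 "MONO-SSA"), written with the
  shared system `S` in the MIDDLE of the product `X × S × Y` — the shape in which a chain
  `[1, l−1] × {l} × [l+1, 2l−1]` uses it (Fawzi–Fawzi–Scalet 2024, proof of Thm 4.1).
* NAMED FACT `relEntropy_partialTrace_le` (Lindblad 1975, Lemma 2 and Theorem,
  p. 149: `S(Tr₂A | Tr₂B) ≤ S(A | B)`, and the same for every trace-preserving completely positive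
  map, in particular for the partial trace over either factor; = Nielsen–Chuang Thm 11.17), in
  the finite special case `ρ, σ` density operators with `σ` and its two marginals positive definite.
* `entropy_increment_nonneg_of_weak_monotonicity` — the arithmetic step of Fawzi–Fawzi–Scalet's proof of
  Theorem 4.1: weak monotonicity plus the two translation-invariance entropy equalities give
  `S(ρ_{XS}) − S(ρ_X) ≥ 0` (PROVED from the named fact; the entropy equalities are hypotheses).
* `entropy_increment_le_tangent_of_relEntropy_partialTrace_le` — the tangent (supporting-hyperplane) form
  `S(ρ) − S(Tr₁ρ) ≤ −Re Tr(ρ log σ) + Re Tr(Tr₁ρ log Tr₁σ)` PROVED from the Lindblad fact via `Re Tr(ρ log ρ) = −S(ρ)`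
  (`re_trace_mul_cfc_log`); this is the linear row an entropy-constrained relaxation adds per cut.
* `vonNeumannEntropy_eq_of_charpoly_eq`, `vonNeumannEntropy_submatrix_equiv` — the entropy depends only on
  the characteristic polynomial, hence is invariant under relabelling the basis (PROVED; this is how a
  translation-invariant chain state supplies the two entropy equalities).

Both named facts are finite-dimensional matrix statements; Mathlib (this tree's version) has
the operator logarithm with its monotonicity/concavity (`CFC.log_monotoneOn`,
`CFC.concaveOn_log`) but neither the von Neumann entropy nor the quantum relative entropy, and
no proof of strong subadditivity (Lieb's concavity theorem), hence the two facts are vendored as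
named `Prop`s; users take `(h : weak_monotonicity)` / `(h : relEntropy_partialTrace_le)`.
Bridge to the lattice vocabulary: the tree's `Literature.MathematicalPhysics.QuantumLattice.spinPartialTrace`
(`SpinPartialTrace.lean`, `Op Λ q`-valued, along an embedding of sites) reduces to `traceLeft`/`traceRight` after the
`Fin.consEquiv`/`Fin.snocEquiv` reindexing recorded there; the statements here are kept on plain product-indexed
matrices so that they are exactly the printed finite-dimensional inequalities.
Not here: strong subadditivity in the form (11.108), the CAR-algebra (fermionic) versions
(Araki–Moriya 2003 Thm 10.1: SSA for every state of the CAR algebra; Moriya 2005 Thm 5: weak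
monotonicity for every EVEN state, false in general for non-even states), infinite systems.

## References

* E. H. Lieb, M. B. Ruskai, *Proof of the strong subadditivity of quantum-mechanical entropy*,
  J. Math. Phys. 14 (1973) 1938–1941. [LiebRuskai1973]
* G. Lindblad, *Completely positive maps and entropy inequalities*, Commun. Math. Phys. 40 (1975)
  147–151, Lemma 2 and Theorem (p. 149). [Lindblad1975]
* M. A. Nielsen, I. L. Chuang, *Quantum Computation and Quantum Information* (10th anniversary
  ed., CUP 2010), §11.3 (11.40), (11.50); §11.4.1 Theorem 11.14 (p. 521); §11.4.2 Theorem 11.17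
  (p. 524). [NielsenChuang2010]
* H. Fawzi, O. Fawzi, S. O. Scalet, *Entropy constraints for ground energy optimization*,
  J. Math. Phys. 65, 032201 (2024) = arXiv:2305.06855, Lemma 2.1, Theorem 4.1.
  [FawziFawziScalet2024Entropy]
* H. Moriya, *Validity and failure of some entropy inequalities for CAR systems*, J. Math. Phys.
  46, 033508 (2005), Theorem 5, Table 1. [Moriya2005]

## Mathlib

Used: `cfc` on `Matrix n n ℂ` (`Matrix.IsHermitian.instContinuousFunctionalCalculus`,
`Matrix.IsHermitian.cfc_eq`, `Matrix.IsHermitian.cfc`, `cfc_mul`, `cfc_neg`, `Matrix.finite_real_spectrum`),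
`Real.negMulLog`, `Matrix.IsHermitian.roots_charpoly_eq_eigenvalues`, `Matrix.charpoly_reindex`,
`Matrix.trace_mul_cycle`, `Matrix.trace_diagonal`.
-/

noncomputable section

open Matrix
open scoped BigOperators ComplexOrder

namespace Literature.InformationTheory.Entropy

open Literature.Computability.QuantumComplexity (traceLeft traceRight IsDensity)

/-! ### Von Neumann entropy and quantum relative entropy of matrices -/

section Entropy

variable {m : Type*} [Fintype m] [DecidableEq m]

/-- **Quantum relative entropy** `S(ρ‖σ) = Tr ρ log ρ − Tr ρ log σ` (Umegaki), through the
functional calculus `log ρ = cfc Real.log ρ`; since Mathlib's `Real.log 0 = 0`, the kernel of `ρ`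
contributes `0 · log 0 = 0` as it should, and the value is the textbook one whenever `σ` is
positive definite (the only case used below; for singular `σ` with `supp ρ ⊄ supp σ` the textbook
value is `+∞`, not represented here). [cite: NielsenChuang2010, §11.3.1 eq. (11.50)]
[cite: Lindblad1975, p.147] -/
def quantumRelEntropy (ρ σ : Matrix m m ℂ) : ℝ :=
  ((ρ * (cfc Real.log ρ - cfc Real.log σ)).trace).re

/-- `S(ρ‖ρ) = 0` (the equality case of Klein's inequality). [cite: NielsenChuang2010, Theorem 11.7] -/
@[simp] theorem quantumRelEntropy_self (ρ : Matrix m m ℂ) : quantumRelEntropy ρ ρ = 0 := by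
  simp [quantumRelEntropy]

/-- **Functional-calculus form of the entropy**: for Hermitian `ρ` the eigenvalue sum
`vonNeumannEntropy ρ = Σᵢ η(λᵢ)` (`VonNeumannEntropy.lean`) equals `Re Tr η(ρ)` with `η(ρ) = cfc η ρ`
(`Matrix.IsHermitian.cfc_eq`: `cfc η ρ = U diag(η(λ)) U⋆`, and the trace is cyclic) — the form in
which `S` meets `Tr(ρ log ρ)` below. [cite: NielsenChuang2010, §11.3 eqs. (11.39)–(11.40)] -/
theorem vonNeumannEntropy_eq_re_trace_cfc_negMulLog {ρ : Matrix m m ℂ} (hρ : ρ.IsHermitian) :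
    vonNeumannEntropy ρ = ((cfc Real.negMulLog ρ).trace).re := by
  rw [vonNeumannEntropy_eq hρ, hρ.cfc_eq, Matrix.IsHermitian.cfc, Unitary.conjStarAlgAut_apply,
    Matrix.trace_mul_cycle, Unitary.coe_star_mul_self, one_mul, Matrix.trace_diagonal]
  simp [Function.comp_def]

/-- **The entropy is a spectral invariant**: `S(ρ)` is the sum of `η(Re z)` over the roots `z` of the
characteristic polynomial of the Hermitian matrix `ρ`, with multiplicity
(`Matrix.IsHermitian.roots_charpoly_eq_eigenvalues`). [cite: NielsenChuang2010, §11.3 eq. (11.40)] -/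
theorem vonNeumannEntropy_eq_sum_roots_charpoly {ρ : Matrix m m ℂ} (hρ : ρ.IsHermitian) :
    vonNeumannEntropy ρ = (ρ.charpoly.roots.map (fun z : ℂ => Real.negMulLog z.re)).sum := by
  rw [vonNeumannEntropy_eq hρ, hρ.roots_charpoly_eq_eigenvalues,
    Multiset.map_map, Finset.sum_eq_multiset_sum]
  simp [Function.comp_def]

/-- Hermitian matrices with the same characteristic polynomial (possibly indexed by different types)
have the same von Neumann entropy. [cite: NielsenChuang2010, §11.3 eq. (11.40)] -/
theorem vonNeumannEntropy_eq_of_charpoly_eq {n : Type*} [Fintype n] [DecidableEq n]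
    {ρ : Matrix m m ℂ} {σ : Matrix n n ℂ} (hρ : ρ.IsHermitian) (hσ : σ.IsHermitian)
    (h : ρ.charpoly = σ.charpoly) : vonNeumannEntropy ρ = vonNeumannEntropy σ := by
  rw [vonNeumannEntropy_eq_sum_roots_charpoly hρ, vonNeumannEntropy_eq_sum_roots_charpoly hσ, h]

/-- **Relabelling the basis does not change the entropy**: `S(ρ ∘ e) = S(ρ)` for a bijection `e` of
index types (`Matrix.charpoly_reindex`). For a translation-invariant state of a chain this gives
`S(ρ_{[l, 2l−1]}) = S(ρ_{[1, l]})` once the two marginals are identified along the shift.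
[cite: NielsenChuang2010, §11.3 eq. (11.40)] -/
theorem vonNeumannEntropy_submatrix_equiv {n : Type*} [Fintype n] [DecidableEq n]
    {ρ : Matrix m m ℂ} (hρ : ρ.IsHermitian) (e : n ≃ m) :
    vonNeumannEntropy (ρ.submatrix e e) = vonNeumannEntropy ρ := by
  have hσ : (ρ.submatrix e e).IsHermitian := hρ.submatrix e
  refine vonNeumannEntropy_eq_of_charpoly_eq hσ hρ ?_
  have : ρ.submatrix e e = Matrix.reindex e.symm e.symm ρ := rfl
  rw [this, Matrix.charpoly_reindex]

end Entropy

/-! ### Marginals of a tripartite state `ρ` on `ℋ_X ⊗ ℋ_S ⊗ ℋ_Y` (index type `X × S × Y`) -/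

section Marginals

variable {X S Y R : Type*} [Fintype X] [Fintype S] [Fintype Y] [NonUnitalNonAssocSemiring R]

/-- **Partial trace over the last factor** of `X × S × Y`: `(Tr_Y ρ)_{(x,s),(x',s')} =
Σ_y ρ_{(x,s,y),(x',s',y)}` — `traceRight` after re-bracketing `X × (S × Y) ≃ (X × S) × Y`.
[cite: NielsenChuang2010, §2.4.3 eq. (2.178)] -/
def traceLast (ρ : Matrix (X × S × Y) (X × S × Y) R) : Matrix (X × S) (X × S) R :=
  traceRight (ρ.submatrix (Equiv.prodAssoc X S Y) (Equiv.prodAssoc X S Y))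

omit [Fintype X] [Fintype S] in
/-- Entries of `Tr_Y`: `(Tr_Y ρ)_{(x,s),(x',s')} = Σ_y ρ_{(x,s,y),(x',s',y)}`. [cite: NielsenChuang2010, §2.4.3 eq. (2.178)] -/
@[simp] theorem traceLast_apply (ρ : Matrix (X × S × Y) (X × S × Y) R) (x x' : X) (s s' : S) :
    traceLast ρ (x, s) (x', s') = ∑ y, ρ (x, s, y) (x', s', y) := by
  simp [traceLast, Literature.Computability.QuantumComplexity.traceRight_apply]

/-- `Tr (Tr_Y ρ) = Tr ρ` (the partial trace is trace preserving). [cite: BurgisserChristandlIkenmeyer2011, §2.2] -/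
theorem trace_traceLast (ρ : Matrix (X × S × Y) (X × S × Y) R) : (traceLast ρ).trace = ρ.trace := by
  rw [traceLast, Literature.Computability.QuantumComplexity.trace_traceRight]
  simp only [Matrix.trace, Matrix.diag, Matrix.submatrix_apply]
  exact Fintype.sum_equiv (Equiv.prodAssoc X S Y) _ _ fun _ => rfl

end Marginals

/-! ### The two named facts -/

/-- NAMED FACT — **weak monotonicity of the von Neumann entropy** (Lieb–Ruskai 1973;
Nielsen–Chuang Theorem 11.14, eq. (11.107): "For any trio of quantum systems `A, B, C`,
`S(A) + S(B) ≤ S(A,C) + S(B,C)`"; equivalently `S(A|C) + S(B|C)`… i.e. Fawzi–Fawzi–Scalet 2024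
Lemma 2.1 `S(A|B)_ρ + S(A|C)_ρ ≥ 0` with the conditioned system renamed, and Moriya's
"MONO-SSA"). Stated for a density operator `ρ` on `ℋ_X ⊗ ℋ_S ⊗ ℋ_Y` with the SHARED system `S`
as the middle factor (`A := X`, `B := Y`, `C := S` in (11.107)):
`S(ρ_X) + S(ρ_Y) ≤ S(ρ_{XS}) + S(ρ_{SY})`, where `ρ_{SY} = Tr_X ρ` (`traceLeft`),
`ρ_{XS} = Tr_Y ρ` (`traceLast`), `ρ_X = Tr_S ρ_{XS}`, `ρ_Y = Tr_S ρ_{SY}`. For a translation-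
invariant state of a chain read on `[1,l−1] × {l} × [l+1,2l−1]` this is
`2 (S(ρ_{[1,l]}) − S(ρ_{[1,l−1]})) ≥ 0` (Fawzi–Fawzi–Scalet 2024, proof of Theorem 4.1). The
tensor-product (distinguishable / Jordan–Wigner) form; the CAR-algebra form holds for even states
only (Moriya 2005, Thm 5). Users take `(h : weak_monotonicity)`.
[cite: LiebRuskai1973] [cite: NielsenChuang2010, Theorem 11.14 eq. (11.107) p.521]
[cite: FawziFawziScalet2024Entropy, Lemma 2.1] -/
def weak_monotonicity : Prop :=
  ∀ (X S Y : Type) [Fintype X] [Fintype S] [Fintype Y] [DecidableEq X] [DecidableEq S]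
    [DecidableEq Y] (ρ : Matrix (X × S × Y) (X × S × Y) ℂ), IsDensity ρ →
    vonNeumannEntropy (traceRight (traceLast ρ)) + vonNeumannEntropy (traceLeft (traceLeft ρ)) ≤
      vonNeumannEntropy (traceLast ρ) + vonNeumannEntropy (traceLeft ρ)

/-- NAMED FACT — **monotonicity of the quantum relative entropy under a partial trace**
(Lindblad 1975, Lemma 2: "Let `ℋ = ℋ₁ ⊗ ℋ₂` and put `A₁ = Tr₂ A` … then `S(A₁|B₁) ≤ S(A|B)`",
proved there from Lieb–Ruskai strong subadditivity, and Theorem p. 149: the same for every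
trace-preserving completely positive map, in particular for the partial trace over either
factor; Nielsen–Chuang Theorem 11.17 `S(ρ^A‖σ^A) ≤ S(ρ^{AB}‖σ^{AB})`). Vendored in the finite
special case used by entropy-constrained relaxations: `ρ, σ` density operators on `ℋ_m ⊗ ℋ_n`
(index `m × n`) with `σ` and its two marginals positive definite (so that all relative
entropies are the finite textbook values, see `quantumRelEntropy`; the marginal hypotheses are
consequences of `σ > 0`, kept explicit as in the requesting cell's ruling D-19 r81 (e)):
`S(Tr₁ρ ‖ Tr₁σ) ≤ S(ρ‖σ)` and `S(Tr₂ρ ‖ Tr₂σ) ≤ S(ρ‖σ)` (`Tr₁ = traceLeft`, `Tr₂ = traceRight`).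
Users take `(h : relEntropy_partialTrace_le)`.
-- TODO(general form): arbitrary positive trace-class `A, B` with `S ∈ [0, ∞]`, and general
-- trace-preserving completely positive maps (Lindblad 1975, Theorem).
[cite: Lindblad1975, Lemma 2 p.149] [cite: NielsenChuang2010, Theorem 11.17 eq. (11.125) p.524] -/
def relEntropy_partialTrace_le : Prop :=
  ∀ (m n : Type) [Fintype m] [Fintype n] [DecidableEq m] [DecidableEq n]
    (ρ σ : Matrix (m × n) (m × n) ℂ), IsDensity ρ → IsDensity σ → σ.PosDef →
    (traceLeft σ).PosDef → (traceRight σ).PosDef →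
    quantumRelEntropy (traceLeft ρ) (traceLeft σ) ≤ quantumRelEntropy ρ σ ∧
      quantumRelEntropy (traceRight ρ) (traceRight σ) ≤ quantumRelEntropy ρ σ

/-! ### The arithmetic step of Fawzi–Fawzi–Scalet's Theorem 4.1 -/

/-- **Weak monotonicity + translation invariance ⇒ the conditional entropy `S(l | 1…l−1)` is
nonnegative** — the two-line proof of Fawzi–Fawzi–Scalet, Theorem 4.1 (first inclusion): "We know
from weak monotonicity that `S(l|1…l−1) + S(l|l+1…2l−1) ≥ 0`. However, translation-invariance tells us
that `S(l|l+1…2l−1) = S(l…2l−1) − S(l+1…2l−1) = S(1…l) − S(1…l−1) = S(l|1…l−1)`, so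
`2 S(l|1…l−1) ≥ 0`." Here `X = [1,l−1]`, `S = {l}`, `Y = [l+1,2l−1]`; the two translation-invariance
equalities `S(ρ_{SY}) = S(ρ_{XS})`, `S(ρ_Y) = S(ρ_X)` are hypotheses (for a concrete chain state they
come from `vonNeumannEntropy_submatrix_equiv` after identifying the shifted marginals), and the
conclusion is `S(ρ_{XS}) − S(ρ_X) ≥ 0`. PROVED from the named fact `weak_monotonicity`.
[cite: FawziFawziScalet2024Entropy, Theorem 4.1 (proof)] -/
theorem entropy_increment_nonneg_of_weak_monotonicity (hWM : weak_monotonicity)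
    {X S Y : Type} [Fintype X] [Fintype S] [Fintype Y] [DecidableEq X] [DecidableEq S]
    [DecidableEq Y] (ρ : Matrix (X × S × Y) (X × S × Y) ℂ) (hρ : IsDensity ρ)
    (hSY : vonNeumannEntropy (traceLeft ρ) = vonNeumannEntropy (traceLast ρ))
    (hY : vonNeumannEntropy (traceLeft (traceLeft ρ)) = vonNeumannEntropy (traceRight (traceLast ρ))) :
    0 ≤ vonNeumannEntropy (traceLast ρ) - vonNeumannEntropy (traceRight (traceLast ρ)) := by
  have h := hWM X S Y ρ hρ
  rw [hSY, hY] at h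
  linarith

/-! ### The tangent (supporting-hyperplane) form of the Lindblad inequality -/

section Tangent

variable {m : Type*} [Fintype m] [DecidableEq m]

/-- `Re Tr(ρ log ρ) = −S(ρ)` for Hermitian `ρ` (`x log x = −η(x)` under the functional calculus; any real
function is continuous on the finite spectrum of a matrix). [cite: NielsenChuang2010, §11.3 eqs. (11.39)–(11.40)] -/
theorem re_trace_mul_cfc_log {ρ : Matrix m m ℂ} (hρ : ρ.IsHermitian) :
    ((ρ * cfc Real.log ρ).trace).re = - vonNeumannEntropy ρ := by
  have hsa : IsSelfAdjoint ρ := hρ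
  have hfin := Matrix.finite_real_spectrum (A := ρ)
  have h1 : cfc (fun x : ℝ => x * Real.log x) ρ = ρ * cfc Real.log ρ := by
    rw [cfc_mul (fun x : ℝ => x) Real.log ρ (hfin.continuousOn _) (hfin.continuousOn _), cfc_id' ℝ ρ]
  have h2 : cfc Real.negMulLog ρ = -(ρ * cfc Real.log ρ) := by
    rw [← h1, Real.negMulLog_eq_neg, cfc_neg]
  rw [vonNeumannEntropy_eq_re_trace_cfc_negMulLog hρ, h2, Matrix.trace_neg, Complex.neg_re, neg_neg]

variable {n : Type*}

omit [DecidableEq m] in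
/-- The partial trace of a Hermitian matrix is Hermitian. [cite: BurgisserChristandlIkenmeyer2011, §2.2] -/
theorem isHermitian_traceLeft {ρ : Matrix (m × n) (m × n) ℂ} (hρ : ρ.IsHermitian) :
    (traceLeft ρ).IsHermitian := by
  ext b b'
  simp only [Matrix.conjTranspose_apply, Literature.Computability.QuantumComplexity.traceLeft_apply,
    star_sum]
  refine Finset.sum_congr rfl fun a _ => ?_
  simpa using congrFun (congrFun hρ (a, b)) (a, b')

/-- **Tangent-row validity (the unfolded Lindblad inequality)**: for density operators `ρ, σ` on
`ℋ_m ⊗ ℋ_n` with `σ` and its marginals positive definite,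
`S(ρ) − S(Tr₁ρ) ≤ −Re Tr(ρ log σ) + Re Tr(Tr₁ρ · log Tr₁σ)`, with equality at `ρ = σ` — the
supporting-hyperplane form of the concavity of the conditional entropy that entropy-constrained
relaxations linearise (Fawzi–Fawzi–Scalet §2: the weak-monotonicity region "defines a convex region …
a consequence of the concavity of the conditional entropy function"). PROVED from the named fact
`relEntropy_partialTrace_le` (it is `D(Tr₁ρ‖Tr₁σ) ≤ D(ρ‖σ)` unfolded with `re_trace_mul_cfc_log`).
[cite: Lindblad1975, Lemma 2 p.149] [cite: FawziFawziScalet2024Entropy, §2 (after Lemma 2.1)] -/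
theorem entropy_increment_le_tangent_of_relEntropy_partialTrace_le (h : relEntropy_partialTrace_le)
    {m n : Type} [Fintype m] [Fintype n] [DecidableEq m] [DecidableEq n]
    (ρ σ : Matrix (m × n) (m × n) ℂ) (hρ : IsDensity ρ) (hσ : IsDensity σ) (hσpd : σ.PosDef)
    (h₁ : (traceLeft σ).PosDef) (h₂ : (traceRight σ).PosDef) :
    vonNeumannEntropy ρ - vonNeumannEntropy (traceLeft ρ) ≤
      -((ρ * cfc Real.log σ).trace).re + ((traceLeft ρ * cfc Real.log (traceLeft σ)).trace).re := by
  have hD := (h m n ρ σ hρ hσ hσpd h₁ h₂).1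
  unfold quantumRelEntropy at hD
  rw [mul_sub, mul_sub, Matrix.trace_sub, Matrix.trace_sub, Complex.sub_re, Complex.sub_re,
    re_trace_mul_cfc_log hρ.1.isHermitian,
    re_trace_mul_cfc_log (isHermitian_traceLeft hρ.1.isHermitian)] at hD
  linarith

end Tangent

/-! ### Discharge of the named fact `relEntropy_partialTrace_le` (Lindblad 1975, Lemma 2)

The fact is PROVED (Petz's relative-modular-operator proof of Lindblad's monotonicity, formalized
in `Literature/LinearAlgebra/Matrix/JensenOperatorInequality.lean` (Hansen–Pedersen–Jensen
operator inequality for `log`), `Literature/LinearAlgebra/Matrix/RelativeModularOperator.lean`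
(Araki's relative modular operator `Δ = (ρ⁻¹)ᵀ ⊗ₖ σ` and `S(ρ‖σ) = −⟨ρ^{1/2}, log Δ ρ^{1/2}⟩`),
`RelativeEntropyMonotonicity.lean` (Petz's isometry, the positive definite case) and
`RelativeEntropyMonotonicityDensity.lean` (second factor by the swap; singular `ρ` by
`ρ_ε = (1 − ε)ρ + εσ`, `ε → 0⁺`)); users' `(h : relEntropy_partialTrace_le)` are fed
`relEntropy_partialTrace_le_holds`. -/

section Discharge

/-- **Lindblad's monotonicity of the quantum relative entropy under the partial traces holds**:
`theorem relEntropy_partialTrace_le_holds : relEntropy_partialTrace_le` — for density matrices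
`ρ, σ` on `ℋ_m ⊗ ℋ_n` with `σ` positive definite, `S(Tr₁ρ ‖ Tr₁σ) ≤ S(ρ‖σ)` and
`S(Tr₂ρ ‖ Tr₂σ) ≤ S(ρ‖σ)` (the two marginal positivity hypotheses of the fact are not needed).
[cite: Lindblad1975, Lemma 2 p.149] [cite: Petz2008, Theorems 3.9–3.10]
[cite: NielsenChuang2010, Theorem 11.17 eq. (11.125) p.524] -/
theorem relEntropy_partialTrace_le_holds : relEntropy_partialTrace_le := by
  intro m n _ _ _ _ ρ σ hρ hσ hσpd _ _
  exact ⟨re_trace_traceLeft_mul_log_sub_log_le_of_density hρ.1 hρ.2 hσpd hσ.2,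
    re_trace_traceRight_mul_log_sub_log_le_of_density hρ.1 hρ.2 hσpd hσ.2⟩

end Discharge

end Literature.InformationTheory.Entropy
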